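import Summits.ResolutionOfSingularities.ResolutionOfSingularities.Theorems.UniformComplexityCampaignW82FamilyResolution
import Mathlib.RingTheory.Unramified.Basic
import Mathlib.RingTheory.Localization.FractionRing
import Mathlib.RingTheory.TensorProduct.Basic
import HarnessLib

/-!
# [OURS · L1 W8.2] RESOLUTION IN FAMILIES WITH SEPARABLE (GENERICALLY ÉTALE) BASE EXTENSIONS —
# the tightness variant of the family form of door 2 (`UniformComplexity` / `PrimeModelTransfer`)

Cell `res-hironaka` (run/shared/lean/pub/res-hironaka/), LADDER-RESOLUTION rung L (RESCUE), slot W8.2 of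
plan/RESCUE-SEED.md («PRIME-FIELD / UNIVERSALITY TRANSFER instead of descent: resolve over 𝔽_p or 𝔽̄_p and
transfer FAMILIES»), door 2: route `UniformComplexity`, item `PrimeModelTransfer`
(stmt-ResolutionOfSingularities-8933). Self-typed by the slot's prover res-L1-s82-pv-2 (gen 7) under the rung-B
precedent (the OURS typer res-L1-type-o6 may supersede docstrings; lanes A/B sign). THESES-FREE module: imports
the OURS vocabulary file `Theorems/UniformComplexityCampaignW82FamilyResolution.lean` (p526769:
`CampaignW82.IsWeakResolution`, `CampaignW82.FamilyResolution`), Mathlib and `HarnessLib`. NOTHING is proved about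
resolution of singularities here and nothing is asserted: one `def` and three pure-logic anchors.

WHY THIS FILE. The family form of the crux (gen 5, FAMILY-FORM.md on stmt-8933; by name
`CampaignW82.primeModelTransfer_iff_familyResolution`, p532272) reads: «𝔽̄_p ⇒ all algebraically closed fields of
characteristic `p`» ⟺ RESOLUTION IN FAMILIES over `𝔽̄_p` — every proper family `𝒳 → Spec A` with integral
geometric generic fibre admits, AFTER A FINITE-TYPE ALGEBRAIC INJECTIVE BASE EXTENSION `A → A'`, one morphism
`G : 𝒴 → 𝒳 ×_A A'` whose fibre over every field-valued point of `Spec A'` is a weak resolution. The slot's row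
in RESCUE-SEED reads the three transport barriers as «transfer must be of FAMILIES with regular total space, not
of fibres»; the docstring of `FamilyResolution` says «the algebraic base extension `A → A'` is where the
inseparability is absorbed». This module types the statement that would make that sentence idle — the SAME
resolution in families, but with the base extension required to be SEPARABLE, i.e. GENERICALLY ÉTALE:

* `FamilyResolutionSep k` — `FamilyResolution k` with the extra conjunct
  `Algebra.FormallyUnramified (Frac A) (Frac A ⊗_A A')`: the generic fibre `Spec (Frac A ⊗_A A') → Spec (Frac A)`
  of the base extension is (formally) unramified. Since `A → A'` is injective, of finite type and algebraic between
  domains, `Frac A ⊗_A A' = A'[(A ∖ 0)⁻¹]` is a domain of finite type and algebraic over the field `Frac A`, hence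
  a FIELD, finite over `Frac A`, namely `Frac A'`; and a finite field extension is formally unramified iff it is
  separable (Mathlib `Algebra.FormallyUnramified.iff_isSeparable`). So the conjunct says exactly: `Frac A' / Frac A`
  is a finite SEPARABLE extension — equivalently `Spec A' → Spec A` is étale over a dense open of `Spec A'`
  («after shrinking the base, an étale base change»), the base changes classical «resolution in families» theorems
  in characteristic zero allow.

THEOREM OF THE PROVER (NOT proved here; gen 7 target, sibling files `…SeparableTightness*.lean`):
**`not_familyResolutionSep : ∀ k` of characteristic `p > 0`, `¬ FamilyResolutionSep k`** — for EVERY field `k`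
of positive characteristic (finite, `𝔽̄_p`, perfect or not). Witness: the compactified Kollár pencil, a proper
integral `𝒳̄ → Spec k[t]` with integral geometric generic fibre containing `y^q = x^p − t` (`q ≠ p` prime) as a
dense open; for a separable `A'`, `t` is not a `p`-th power in `Frac A'`, the fibre of `G` over the GEOMETRIC
generic point is a weak resolution with regular — hence smooth — source, so by fpqc descent the fibre over the
generic point `Spec (Frac A')` has a source SMOOTH over `Frac A'` and is proper and an isomorphism over a non-empty
open: restricted over the twist curve this is a smooth proper birational model of `y^q = x^p − t` over a field in
which `t` is not a `p`-th power, which does not exist (`TwistExponent.no_smooth_model_twistCurve`, p509195). By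
contrast the RADICIAL variant `CampaignW82.FamilyResolutionInsep p k` (door 1, p533235) is EQUIVALENT to
resolution over perfect fields (`perfectRes_iff_familyResolutionInsep`, p535806): the base extension in resolution
in families must be inseparable and may be taken purely inseparable.

BUILD RULE (cell, director-resolution 2026-08-26T18:53:29Z (B)): OURS vocabulary file, THESES-FREE BY BIRTH.

HONEST FRAMING. The `def` below is OURS — a campaign statement that REPLACES THE ROLE of a printed item of
H. Hironaka's manuscript *Resolution of singularities in positive characteristics* (2017-03-23, [Hironaka2017],
lit key `paper:url-3343fd9e678b`) — namely §17 ¶2, p.89 l.59–62 («In this work the base field K is always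
assumed to be a finite field or Z/pZ because our resolution is for all dimension. When the K has transcendence
degree d we can reformulate the resolution problem to the case of dimension d + dim Z.», typed AS PRINTED as
`S17Methodology.U89_2` / `U89_3`), in its NEGATIVE-SIDE bookkeeping role: it isolates which base changes the
reformulation «variety over a field of transcendence degree `d` ↦ family of dimension `d + dim Z`» may use if it
is to return resolutions over algebraically closed ground fields. Hironaka's statements are CANDIDATES under
adjudication (D-0012/D-0089); nothing here is attributed to the author and no verdict on the manuscript is
implied. AI typing, weaker than expert review.

VACUITY SELF-CHECK. `FamilyResolutionSep k` is a STRENGTHENING of `FamilyResolution k` (anchor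
`familyResolution_of_familyResolutionSep`, pure logic) and is the statement the prover REFUTES for `k` of positive
characteristic (so it is «vacuous» exactly in the informative sense of a tightness statement: its negation is the
theorem); it is not trivially false by its form — in characteristic `0` every algebraic extension of `Frac A` is
separable, the extra conjunct is idle and `FamilyResolutionSep k ↔ FamilyResolution k` (resolution in families in
characteristic zero, a consequence of Hironaka 1964 not used or typed here); and it is not trivially true (it
implies `FamilyResolution k`, open in fibre dimension `≥ 4` in characteristic `p`, anchor). The hypothesis class
(proper families with integral geometric generic fibre over finitely generated `k`-domains) is verbatim that of
`FamilyResolution k`, so the two statements differ ONLY in the separability conjunct.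

## References (vocabulary and locators only; nothing cited as a premise)
* H. Hironaka, ms. 2017-03-23, §17 ¶2 p.89 l.59–62 — under adjudication, quoted for the role replaced, not
  asserted. [Hironaka2017]
* J. Kollár, *Lectures on Resolution of Singularities* (2007), 1.19 (the regular, non-smooth curve
  `y^q = x^p − t`). [Kollar2007]
* A. Grothendieck, J. Dieudonné, EGA IV₄ (1967) 17.6.1/17.6.2 (unramified ⟺ étale over a field; separable
  extensions). [EGAIV4]
* The Stacks Project, Tags 00UU (unramified over a field), 02GL. [StacksProject]
* Theorems/UniformComplexityCampaignW82FamilyResolution.lean (p526769), …FamilyResolutionLinks.lean (p532272),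
  …FamilyResolutionInsep.lean (p533235) — cell files, OURS.
-/

noncomputable section

set_option linter.dupNamespace false -- mandated namespace of this single-conjunct summit

open _root_.CategoryTheory _root_.CategoryTheory.Limits _root_.AlgebraicGeometry
open scoped TensorProduct

namespace Summit.ResolutionOfSingularities.ResolutionOfSingularities.Theorems.CampaignW82

/-! ## Resolution in families with separable base extensions -/

/-- [OURS · L1 W8.2 door 2, tightness] replaces the role of §17 ¶2, p.89 l.59–62 («When the K has transcendence
degree d we can reformulate the resolution problem to the case of dimension d + dim Z»; `S17Methodology.U89_3`)
on the NEGATIVE side — which base changes such a reformulation may use; NOT a statement of the manuscript.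
**RESOLUTION IN FAMILIES over `k` WITH SEPARABLE (GENERICALLY ÉTALE) BASE EXTENSIONS.** Verbatim
`CampaignW82.FamilyResolution k` (p526769) — for every finitely generated `k`-domain `A` and every PROPER
`f : 𝒳 → Spec A` whose geometric generic fibre `𝒳 ×_A Spec (Frac A)^{alg}` is integral, there are a domain `A'`,
an INJECTIVE, FINITE-TYPE, ALGEBRAIC `A`-algebra, and ONE morphism `G : 𝒴 → 𝒳 ×_A Spec A'` whose fibre over
EVERY field-valued point `φ : A' → Ω` is a weak resolution (`CampaignW82.IsWeakResolution`: proper, regular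
source, isomorphism over a non-empty open) — with ONE EXTRA CONJUNCT on the base extension:
`Algebra.FormallyUnramified (FractionRing A) (FractionRing A ⊗[A] A')`, i.e. the generic fibre
`A'[(A ∖ 0)⁻¹] = Frac A ⊗_A A'` of `Spec A' → Spec A` is unramified over the field `Frac A`. For `A → A'`
injective, of finite type and algebraic between domains, `Frac A ⊗_A A'` is the field `Frac A'`, finite over
`Frac A`, and the conjunct says precisely that `Frac A' / Frac A` is SEPARABLE (Mathlib
`Algebra.FormallyUnramified.iff_isSeparable`), equivalently that `Spec A' → Spec A` is étale over a dense open
of `Spec A'`. Intended theorem (res-L1-s82-pv-2 gen 7, sibling files `…SeparableTightness*`): for every field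
`k` of characteristic `p > 0`, `¬ FamilyResolutionSep k` (compactified Kollár pencil `y^q = x^p − t` over `k[t]`;
`TwistExponent.no_smooth_model_twistCurve` + fpqc descent of smoothness from the geometric generic fibre).
Contrast: the radicial variant `CampaignW82.FamilyResolutionInsep p k` is equivalent to resolution over perfect
fields (p535806). Vacuity: a strengthening of `FamilyResolution k` (anchor below), hence not trivially true
(open in fibre dimension `≥ 4`); refuted by the prover in characteristic `p` — the informative content of a
tightness statement; in characteristic `0` the extra conjunct is idle. Composite or zero characteristic: not
intended. [folklore] -/
def FamilyResolutionSep (k : Type) [Field k] : Prop :=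
  ∀ (A : Type) [CommRing A] [IsDomain A] [Algebra k A], Algebra.FiniteType k A →
    ∀ (𝒳 : Scheme.{0}) (f : 𝒳 ⟶ Spec (.of A)), IsProper f →
      IsIntegral (pullback f (Spec.map (CommRingCat.ofHom
          (algebraMap A (AlgebraicClosure (FractionRing A)))))) →
      ∃ (A' : Type) (_ : CommRing A') (_ : IsDomain A') (_ : Algebra A A'),
        Function.Injective (algebraMap A A') ∧ Algebra.FiniteType A A' ∧ Algebra.IsAlgebraic A A' ∧
        Algebra.FormallyUnramified (FractionRing A) (FractionRing A ⊗[A] A') ∧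
        ∃ (𝒴 : Scheme.{0})
          (G : 𝒴 ⟶ pullback f (Spec.map (CommRingCat.ofHom (algebraMap A A')))),
          ∀ (Ω : Type) [Field Ω] (φ : A' →+* Ω),
            IsWeakResolution
              (pullback.snd G
                (pullback.fst (pullback.snd f (Spec.map (CommRingCat.ofHom (algebraMap A A'))))
                  (Spec.map (CommRingCat.ofHom φ))))

/-- Anchor (pure logic): dropping the separability conjunct, `FamilyResolutionSep k → FamilyResolution k` — the
separable variant is a STRENGTHENING of resolution in families, so its refutation in characteristic `p` is a
statement about the base extension only. [folklore] -/
theorem familyResolution_of_familyResolutionSep {k : Type} [Field k] (h : FamilyResolutionSep k) :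
    FamilyResolution k := by
  intro A _ _ _ hA 𝒳 f hf hint
  obtain ⟨A', _, _, _, hinj, hft, halg, -, 𝒴, G, hG⟩ := h A hA 𝒳 f hf hint
  exact ⟨A', ‹_›, ‹_›, ‹_›, hinj, hft, halg, 𝒴, G, hG⟩

/-- Anchor (pure logic): `FamilyResolutionSep k` delivers, for a given proper family with integral geometric
generic fibre, the separable base extension and the simultaneous weak resolution — the `∃` unpacked once.
[folklore] -/
theorem FamilyResolutionSep.exists_weakResolution {k : Type} [Field k] (h : FamilyResolutionSep k)
    (A : Type) [CommRing A] [IsDomain A] [Algebra k A] [Algebra.FiniteType k A]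
    (𝒳 : Scheme.{0}) (f : 𝒳 ⟶ Spec (.of A)) [IsProper f]
    (hint : IsIntegral (pullback f (Spec.map (CommRingCat.ofHom
      (algebraMap A (AlgebraicClosure (FractionRing A))))))) :
    ∃ (A' : Type) (_ : CommRing A') (_ : IsDomain A') (_ : Algebra A A'),
      Function.Injective (algebraMap A A') ∧ Algebra.FiniteType A A' ∧ Algebra.IsAlgebraic A A' ∧
      Algebra.FormallyUnramified (FractionRing A) (FractionRing A ⊗[A] A') ∧
      ∃ (𝒴 : Scheme.{0})
        (G : 𝒴 ⟶ pullback f (Spec.map (CommRingCat.ofHom (algebraMap A A')))),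
        ∀ (Ω : Type) [Field Ω] (φ : A' →+* Ω),
          IsWeakResolution
            (pullback.snd G
              (pullback.fst (pullback.snd f (Spec.map (CommRingCat.ofHom (algebraMap A A'))))
                (Spec.map (CommRingCat.ofHom φ)))) :=
  h A ‹_› 𝒳 f ‹_› hint

/-- Anchor (pure logic, the shape of the prover's refutation): if for SOME finitely generated `k`-domain `A` and
SOME proper family `f : 𝒳 → Spec A` with integral geometric generic fibre NO separable base extension carries a
simultaneous weak resolution of the fibres, then `¬ FamilyResolutionSep k`. [folklore] -/
theorem not_familyResolutionSep_of_witness {k : Type} [Field k]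
    (A : Type) [CommRing A] [IsDomain A] [Algebra k A] [Algebra.FiniteType k A]
    (𝒳 : Scheme.{0}) (f : 𝒳 ⟶ Spec (.of A)) [IsProper f]
    (hint : IsIntegral (pullback f (Spec.map (CommRingCat.ofHom
      (algebraMap A (AlgebraicClosure (FractionRing A)))))))
    (hno : ∀ (A' : Type) [CommRing A'] [IsDomain A'] [Algebra A A'],
      Function.Injective (algebraMap A A') → Algebra.FiniteType A A' → Algebra.IsAlgebraic A A' →
      Algebra.FormallyUnramified (FractionRing A) (FractionRing A ⊗[A] A') →
      ∀ (𝒴 : Scheme.{0})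
        (G : 𝒴 ⟶ pullback f (Spec.map (CommRingCat.ofHom (algebraMap A A')))),
        ¬ ∀ (Ω : Type) [Field Ω] (φ : A' →+* Ω),
          IsWeakResolution
            (pullback.snd G
              (pullback.fst (pullback.snd f (Spec.map (CommRingCat.ofHom (algebraMap A A'))))
                (Spec.map (CommRingCat.ofHom φ))))) :
    ¬ FamilyResolutionSep k := by
  intro h
  obtain ⟨A', _, _, _, hinj, hft, halg, hsep, 𝒴, G, hG⟩ := h A ‹_› 𝒳 f ‹_› hint
  exact hno A' hinj hft halg hsep 𝒴 G hG

end Summit.ResolutionOfSingularities.ResolutionOfSingularities.Theorems.CampaignW82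

end
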